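import Summits.ValiantsHypothesis.ValiantsHypothesis.Theses.LacunarySymmetroid
import Summits.ValiantsHypothesis.ValiantsHypothesis.Theorems.LacunarySymmetroidMatrixDescartesCensusPivotDefs
import Summits.ValiantsHypothesis.ValiantsHypothesis.Theorems.LacunarySymmetroidMatrixDescartesLiftNormalForm

/-!
# `MatrixDescartes` census — pivot column ⇒ crux: the law-level pivot-index rungs PIL_K / PIL′ / PIL imply `MatrixDescartes`

HONEST FRAMING.  Object-search cell `pub-symmetroid`, typer g8.  This file proves IMPLICATIONS between statements that are
ALL OPEN: the law-level tops of conjb-1's index-graded Conjecture-B column (`…CensusPivotDefs.lean`: `PivotIndexLawK`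
«`Z₊ ≤ 2^{CK}·m·(q+1)^{C log₂(m+1)}`», `PivotIndexLawPoly` = C1′ «`Z₊ ≤ (m(K+1))^C·(q+1)^{C log₂(m+1)}`», `PivotIndexLaw`
«`Z₊ ≤ 2m·(q+1)^{C log₂(m+1)}`», each for every pivot pencil of format `(m,K)` and index `≤ q`) each imply the route crux
`Theses.LacunarySymmetroid.MatrixDescartes` (stmt-ValiantsHypothesis-18050) — the kernel form of conjb-1 g0's bookkeeping note
«PIL_K ⇒ B-shape ⇒ MDR via the lift» (`ConjB1Sketch.lean`, NOTES-conjb1 §1), here routed DIRECTLY through the tree's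
OneIndefinite normal form `matrixDescartes_of_oneIndefinitePos` (`…LiftNormalForm.lean`: the matrix Descartes rule in
positive-root currency for pencils `X^e J + ∑ X^{dₖ} Pₖ`, `Pₖ ⪰ 0`, implies the crux).  Three steps: (i) at FULL index `q = m`
a pivot law bounds every pivot pencil, since every real symmetric `J` has `J + W Wᵀ ⪰ 0` with `W = √γ • I`,
`γ = 1 + ∑ J_ij²` (tree `stub_psdDominate`); (ii) transport from arbitrary finite index types to `Fin` (`Matrix.reindex`,
`det_submatrix_equiv_self`); (iii) regime arithmetic: with `L = ⌊log₂K⌋`, `m ≤ 2^{(L+c)^c}` the common dominating bound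
`β(m,K) = 2^{CK}·(m(K+1))^C·(m+1)^{C⌊log₂(m+1)⌋}` has `β^q ≤ 2^{K·L}` for `K ≥ K₀(C,c,q)` (tree `StubArith4.exp_le`).
It proves NOTHING unconditionally about the crux, says nothing about `KPlusLogSqLaw` itself (no implication between B and
the PIL family is claimed here), nothing about the census registers, and nothing about `VP ≠ VNP`; like
`Census.matrixDescartes_of_kPlusLogSqLaw` it records which typed laws of the cell are crux-sufficient.  Located facts of
record: the `q = 1`, `K`-free instance R1 of PIL is REFUTED (`…CensusPivotRankOne.lean`), so these laws can only hold with
the `2^{CK}` / `log` factors doing real work.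

[folklore] Elementary bookkeeping (reindexing, `W = √γ•I`, `ℕ` arithmetic); the normal form is the tree's.
-/

-- `Summit.ValiantsHypothesis.ValiantsHypothesis.…` repeats a component by the D-0017 layout
-- (single-conjunct summit), which the `dupNamespace` linter flags; the name is mandated.
set_option linter.dupNamespace false

namespace Summit.ValiantsHypothesis.ValiantsHypothesis.Theorems.LacunarySymmetroidMatrixDescartes.Pivot

open Summit.ValiantsHypothesis.ValiantsHypothesis.Theses.LacunarySymmetroid (MatrixDescartes)
open scoped BigOperators Matrix
open Polynomial

/-! ## (i) Full index and (ii) transport -/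

/-- full index: every real symmetric `J` has `J + W Wᵀ ⪰ 0` for `W = √γ • 1`, `γ = 1 + ∑ J_ij²` (tree `stub_psdDominate`). -/
theorem exists_index_full {m : ℕ} (J : Matrix (Fin m) (Fin m) ℝ) (hJ : J.IsSymm) :
    ∃ W : Matrix (Fin m) (Fin m) ℝ, (J + W * Wᵀ).PosSemidef := by
  set γ : ℝ := 1 + ∑ i, ∑ j, (-J) i j ^ 2 with hγ
  have hγ0 : 0 ≤ γ := by
    have : 0 ≤ ∑ i, ∑ j, (-J) i j ^ 2 := Finset.sum_nonneg fun i _ => Finset.sum_nonneg fun j _ => sq_nonneg _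
    linarith
  have hdom := stub_psdDominate m (-J) hJ.neg
  refine ⟨Real.sqrt γ • (1 : Matrix (Fin m) (Fin m) ℝ), ?_⟩
  have hW : (Real.sqrt γ • (1 : Matrix (Fin m) (Fin m) ℝ)) * (Real.sqrt γ • (1 : Matrix (Fin m) (Fin m) ℝ))ᵀ
      = γ • (1 : Matrix (Fin m) (Fin m) ℝ) := by
    rw [Matrix.transpose_smul, Matrix.transpose_one, Matrix.smul_mul, Matrix.mul_smul, Matrix.one_mul, smul_smul,
      Real.mul_self_sqrt hγ0]
  rw [hW, show J + γ • (1 : Matrix (Fin m) (Fin m) ℝ) = γ • 1 - (-J) by rw [sub_neg_eq_add, add_comm]]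
  exact hdom

/-- A pivot law at full index `q = m` bounds EVERY pivot pencil of format `(m, K)` (no index hypothesis). -/
theorem le_of_pivotRootLawAt_full {m K B : ℕ} (h : PivotRootLawAt m K m B) (e : ℕ) (d : Fin K → ℕ)
    (J : Matrix (Fin m) (Fin m) ℝ) (P : Fin K → Matrix (Fin m) (Fin m) ℝ) (hJ : J.IsSymm)
    (hP : ∀ k, (P k).PosSemidef) : pivotPosRoots e d J P ≤ B :=
  h e d J P hJ hP (exists_index_full J hJ)

/-- Transport: reindexing rows/columns by `σ : ι ≃ Fin m` and letters by `τ : κ ≃ Fin K` turns an arbitrarily indexed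
pivot pencil into a `Fin`-indexed one with the same determinant. -/
theorem det_pivot_reindex {ι κ : Type} [Fintype ι] [DecidableEq ι] [Fintype κ] {m K : ℕ}
    (σ : ι ≃ Fin m) (τ : κ ≃ Fin K) (e : ℕ) (d : κ → ℕ) (J : Matrix ι ι ℝ) (P : κ → Matrix ι ι ℝ) :
    Matrix.det (((X : ℝ[X]) ^ e) • (Matrix.reindex σ σ J).map Polynomial.C
        + ∑ k, ((X : ℝ[X]) ^ (d (τ.symm k))) • (Matrix.reindex σ σ (P (τ.symm k))).map Polynomial.C)
      = Matrix.det (((X : ℝ[X]) ^ e) • J.map Polynomial.C + ∑ k, ((X : ℝ[X]) ^ d k) • (P k).map Polynomial.C) := by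
  have hM : ((X : ℝ[X]) ^ e) • (Matrix.reindex σ σ J).map Polynomial.C
        + ∑ k, ((X : ℝ[X]) ^ (d (τ.symm k))) • (Matrix.reindex σ σ (P (τ.symm k))).map Polynomial.C
      = Matrix.reindex σ σ (((X : ℝ[X]) ^ e) • J.map Polynomial.C
          + ∑ k, ((X : ℝ[X]) ^ d k) • (P k).map Polynomial.C) := by
    refine Matrix.ext fun i j => ?_
    simp only [Matrix.reindex_apply, Matrix.submatrix_apply, Matrix.add_apply, Matrix.smul_apply, Matrix.map_apply,
      Matrix.sum_apply]
    rw [add_right_inj]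
    exact Equiv.sum_comp τ.symm (fun k => ((X : ℝ[X]) ^ d k) • Polynomial.C (P k (σ.symm i) (σ.symm j)))
  rw [hM, Matrix.reindex_apply, Matrix.det_submatrix_equiv_self]

/-- **A `Fin`-indexed pivot law at full index bounds arbitrarily indexed pivot pencils** (the shape of the crux's
OneIndefinite normal form `matrixDescartes_of_oneIndefinitePos`). -/
theorem card_posRoots_le_of_pivotLaw {ι κ : Type} [Fintype ι] [DecidableEq ι] [Fintype κ] {B : ℕ}
    (h : PivotRootLawAt (Fintype.card ι) (Fintype.card κ) (Fintype.card ι) B)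
    (e : ℕ) (d : κ → ℕ) (J : Matrix ι ι ℝ) (P : κ → Matrix ι ι ℝ) (hJ : J.IsSymm) (hP : ∀ k, (P k).PosSemidef) :
    ((Matrix.det (((X : ℝ[X]) ^ e) • J.map Polynomial.C
        + ∑ k, ((X : ℝ[X]) ^ d k) • (P k).map Polynomial.C)).roots.toFinset.filter (fun t => 0 < t)).card ≤ B := by
  classical
  set σ := Fintype.equivFin ι
  set τ := Fintype.equivFin κ
  have hJ' : (Matrix.reindex σ σ J).IsSymm := by
    unfold Matrix.IsSymm at hJ ⊢
    rw [Matrix.reindex_apply, Matrix.transpose_submatrix, hJ]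
  have hP' : ∀ k, (Matrix.reindex σ σ (P (τ.symm k))).PosSemidef := fun k => by
    rw [Matrix.reindex_apply]
    exact (hP (τ.symm k)).submatrix σ.symm
  have hb := le_of_pivotRootLawAt_full h e (fun k => d (τ.symm k)) (Matrix.reindex σ σ J)
    (fun k => Matrix.reindex σ σ (P (τ.symm k))) hJ' hP'
  unfold pivotPosRoots at hb
  rwa [det_pivot_reindex σ τ e d J P] at hb

/-! ## (iii) Regime arithmetic -/

/-- polylog pieces: with `L = ⌊log₂ K⌋`, `ℓ = (L+c)^c`: `(ℓ + L + 1) + (ℓ+1)² ≤ 8 (L + (2c+2))^(2c+2)`. -/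
theorem polylog_aux (L c : ℕ) :
    ((L + c) ^ c + L + 1) + ((L + c) ^ c + 1) ^ 2 ≤ 8 * (L + (2 * c + 2)) ^ (2 * c + 2) := by
  set ℓ := (L + c) ^ c with hℓ
  set D := (L + (2 * c + 2)) ^ (c + 1) with hD
  have hD1 : 1 ≤ D := Nat.one_le_pow _ _ (by omega)
  -- ℓ ≤ D and L + 1 ≤ D
  have h1 : ℓ ≤ D := by
    calc ℓ = (L + c) ^ c := rfl
      _ ≤ (L + (2 * c + 2)) ^ c := Nat.pow_le_pow_left (by omega) c
      _ ≤ (L + (2 * c + 2)) ^ (c + 1) := Nat.pow_le_pow_right (by omega) (by omega)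
  have h2 : L + 1 ≤ D := by
    calc L + 1 ≤ L + (2 * c + 2) := by omega
      _ ≤ (L + (2 * c + 2)) ^ (c + 1) := Nat.le_self_pow (by omega) _
  have hA : ℓ + L + 1 ≤ 2 * D := by omega
  have hsq : D ^ 2 = (L + (2 * c + 2)) ^ (2 * c + 2) := by
    rw [hD, ← pow_mul]; ring_nf
  rw [← hsq]
  nlinarith [hA, h1, hD1]

/-- **Regime arithmetic**: the bound `β(m,K) = 2^{CK}·(m(K+1))^C·(m+1)^{C⌊log₂(m+1)⌋}` satisfies `β^q ≤ 2^{K⌊log₂K⌋}`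
for `K ≥ K₀(C,c,q)` and `m ≤ 2^{(⌊log₂K⌋+c)^c}` (tree `StubArith4.exp_le` for the polylog part). -/
theorem beta_pow_le (C c q : ℕ) : ∃ K₀ : ℕ, ∀ K m : ℕ, K₀ ≤ K → m ≤ 2 ^ ((Nat.log 2 K + c) ^ c) →
    (2 ^ (C * K) * (m * (K + 1)) ^ C * (m + 1) ^ (C * Nat.log 2 (m + 1))) ^ q ≤ 2 ^ (K * Nat.log 2 K) := by
  obtain ⟨K₁, hK₁⟩ := StubArith4.exp_le (2 * c + 2) (16 * q * C)
  refine ⟨max K₁ (2 ^ (2 * q * C)), fun K m hK hm => ?_⟩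
  have hK1 : K₁ ≤ K := le_of_max_le_left hK
  have hK2 : 2 ^ (2 * q * C) ≤ K := le_of_max_le_right hK
  set L := Nat.log 2 K with hL
  set ℓ := (L + c) ^ c with hℓ
  have hqL : 2 * q * C ≤ L := Nat.le_log_of_pow_le one_lt_two hK2
  have hb : K + 1 ≤ 2 ^ (L + 1) := Nat.lt_pow_succ_log_self one_lt_two K
  have hc : m + 1 ≤ 2 ^ (ℓ + 1) := by
    have := Nat.one_le_two_pow (n := ℓ)
    rw [pow_succ]; omega
  have hd : Nat.log 2 (m + 1) ≤ ℓ + 1 :=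
    (Nat.log_mono_right hc).trans (by rw [Nat.log_pow one_lt_two])
  -- β ≤ 2 ^ E
  have hβ : 2 ^ (C * K) * (m * (K + 1)) ^ C * (m + 1) ^ (C * Nat.log 2 (m + 1))
      ≤ 2 ^ (C * (K + (ℓ + L + 1) + (ℓ + 1) ^ 2)) := by
    have e1 : (m * (K + 1)) ^ C ≤ 2 ^ (C * (ℓ + L + 1)) := by
      calc (m * (K + 1)) ^ C ≤ (2 ^ ℓ * 2 ^ (L + 1)) ^ C := Nat.pow_le_pow_left (Nat.mul_le_mul hm hb) C
        _ = 2 ^ (C * (ℓ + L + 1)) := by rw [← pow_add, ← pow_mul]; ring_nf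
    have e2 : (m + 1) ^ (C * Nat.log 2 (m + 1)) ≤ 2 ^ (C * (ℓ + 1) ^ 2) := by
      calc (m + 1) ^ (C * Nat.log 2 (m + 1)) ≤ (m + 1) ^ (C * (ℓ + 1)) :=
            Nat.pow_le_pow_right (by omega) (Nat.mul_le_mul_left C hd)
        _ ≤ (2 ^ (ℓ + 1)) ^ (C * (ℓ + 1)) := Nat.pow_le_pow_left hc _
        _ = 2 ^ (C * (ℓ + 1) ^ 2) := by rw [← pow_mul]; ring_nf
    calc 2 ^ (C * K) * (m * (K + 1)) ^ C * (m + 1) ^ (C * Nat.log 2 (m + 1))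
        ≤ 2 ^ (C * K) * 2 ^ (C * (ℓ + L + 1)) * 2 ^ (C * (ℓ + 1) ^ 2) :=
          Nat.mul_le_mul (Nat.mul_le_mul_left _ e1) e2
      _ = 2 ^ (C * (K + (ℓ + L + 1) + (ℓ + 1) ^ 2)) := by rw [← pow_add, ← pow_add]; ring_nf
  -- q · E ≤ K · L
  have hpoly := polylog_aux L c
  have h1 : 16 * q * C * (L + (2 * c + 2)) ^ (2 * c + 2) ≤ K * L := hK₁ K hK1
  set R := (ℓ + L + 1) + (ℓ + 1) ^ 2 with hR
  have h2 : 2 * (q * C * K) ≤ K * L := by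
    calc 2 * (q * C * K) = K * (2 * q * C) := by ring
      _ ≤ K * L := Nat.mul_le_mul_left K hqL
  have h3 : 2 * (q * C * R) ≤ K * L := by
    calc 2 * (q * C * R) ≤ 2 * (q * C * (8 * (L + (2 * c + 2)) ^ (2 * c + 2))) :=
          Nat.mul_le_mul_left 2 (Nat.mul_le_mul_left _ hpoly)
      _ = 16 * q * C * (L + (2 * c + 2)) ^ (2 * c + 2) := by ring
      _ ≤ K * L := h1
  have hE : q * (C * (K + (ℓ + L + 1) + (ℓ + 1) ^ 2)) ≤ K * L := by
    have e : q * (C * (K + (ℓ + L + 1) + (ℓ + 1) ^ 2)) = q * C * K + q * C * R := by rw [hR]; ring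
    rw [e]
    omega
  calc (2 ^ (C * K) * (m * (K + 1)) ^ C * (m + 1) ^ (C * Nat.log 2 (m + 1))) ^ q
      ≤ (2 ^ (C * (K + (ℓ + L + 1) + (ℓ + 1) ^ 2))) ^ q := Nat.pow_le_pow_left hβ q
    _ = 2 ^ (q * (C * (K + (ℓ + L + 1) + (ℓ + 1) ^ 2))) := by rw [← pow_mul, mul_comm]
    _ ≤ 2 ^ (K * L) := Nat.pow_le_pow_right (by norm_num) hE

/-! ## The bridges -/

/-- **Master bridge**: a pivot law at full index with the dominating bound
`β(m,K) = 2^{CK}·(m(K+1))^C·(m+1)^{C⌊log₂(m+1)⌋}` implies the crux `MatrixDescartes`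
(via the tree's `matrixDescartes_of_oneIndefinitePos`).  Both sides open; only the implication is proved. [folklore] -/
theorem matrixDescartes_of_pivot_bound (C : ℕ)
    (h : ∀ m K : ℕ, PivotRootLawAt m K m (2 ^ (C * K) * (m * (K + 1)) ^ C * (m + 1) ^ (C * Nat.log 2 (m + 1)))) :
    MatrixDescartes := by
  refine matrixDescartes_of_oneIndefinitePos fun c q _hq => ?_
  obtain ⟨K₀, hK₀⟩ := beta_pow_le C c q
  refine ⟨K₀, ?_⟩
  intro ι κ _ _ _ hK hm e d J P hJ hP
  have hZ := card_posRoots_le_of_pivotLaw (h (Fintype.card ι) (Fintype.card κ)) e d J P hJ hP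
  exact (Nat.pow_le_pow_left hZ q).trans (hK₀ _ _ hK hm)

/-- **PIL′ = C1′ ⇒ crux**: `PivotIndexLawPoly → MatrixDescartes` (conjb-1 g1's top rung is crux-sufficient). [folklore] -/
theorem matrixDescartes_of_pivotIndexLawPoly (h : PivotIndexLawPoly) : MatrixDescartes := by
  obtain ⟨C, hC⟩ := h
  refine matrixDescartes_of_pivot_bound C fun m K => pivotRootLawAt_mono (hC m K m) ?_
  exact Nat.mul_le_mul_right _ (Nat.le_mul_of_pos_left _ (Nat.two_pow_pos _))

/-- **PIL_K ⇒ crux**: `PivotIndexLawK → MatrixDescartes` (conjb-1 g0: «PIL_K ⇒ `KPlusLogSqLaw` via the lift ⇒ MDR»; here the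
direct route, with `C ↦ C + 1` to dominate the bound). [folklore] -/
theorem matrixDescartes_of_pivotIndexLawK (h : PivotIndexLawK) : MatrixDescartes := by
  obtain ⟨C, hC⟩ := h
  refine matrixDescartes_of_pivot_bound (C + 1) fun m K => pivotRootLawAt_mono (hC m K m) ?_
  have h1 : 2 ^ (C * K) ≤ 2 ^ ((C + 1) * K) := Nat.pow_le_pow_right two_pos (Nat.mul_le_mul_right K (Nat.le_succ C))
  have h2 : m ≤ (m * (K + 1)) ^ (C + 1) :=
    calc m ≤ m * (K + 1) := Nat.le_mul_of_pos_right m (Nat.succ_pos K)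
      _ ≤ (m * (K + 1)) ^ (C + 1) := Nat.le_self_pow (Nat.succ_ne_zero C) _
  have h3 : (m + 1) ^ (C * Nat.log 2 (m + 1)) ≤ (m + 1) ^ ((C + 1) * Nat.log 2 (m + 1)) :=
    Nat.pow_le_pow_right (Nat.succ_pos m) (Nat.mul_le_mul_right _ (Nat.le_succ C))
  exact Nat.mul_le_mul (Nat.mul_le_mul h1 h2) h3

/-- **PIL ⇒ crux**: `PivotIndexLaw → MatrixDescartes` (the `K`-free pivot-index law; its `log` factor absorbs the leading `2`
for `m ≥ 1`). [folklore] -/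
theorem matrixDescartes_of_pivotIndexLaw (h : PivotIndexLaw) : MatrixDescartes := by
  obtain ⟨C, hC⟩ := h
  refine matrixDescartes_of_pivot_bound (C + 1) fun m K => pivotRootLawAt_mono (hC m K m) ?_
  -- 2m(m+1)^{C log(m+1)} ≤ 2^{(C+1)K} (m(K+1))^{C+1} (m+1)^{(C+1) log(m+1)}
  rcases Nat.eq_zero_or_pos m with rfl | hm
  · simp
  have hlog : 1 ≤ Nat.log 2 (m + 1) := Nat.succ_le_of_lt (Nat.log_pos one_lt_two (by omega))
  have h1 : 1 ≤ 2 ^ ((C + 1) * K) := Nat.one_le_two_pow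
  have h2 : m ≤ (m * (K + 1)) ^ (C + 1) :=
    calc m ≤ m * (K + 1) := Nat.le_mul_of_pos_right m (Nat.succ_pos K)
      _ ≤ (m * (K + 1)) ^ (C + 1) := Nat.le_self_pow (Nat.succ_ne_zero C) _
  have h3 : 2 * (m + 1) ^ (C * Nat.log 2 (m + 1)) ≤ (m + 1) ^ ((C + 1) * Nat.log 2 (m + 1)) := by
    have e : (C + 1) * Nat.log 2 (m + 1) = Nat.log 2 (m + 1) + C * Nat.log 2 (m + 1) := by ring
    rw [e, pow_add]
    refine Nat.mul_le_mul_right _ ?_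
    calc 2 ≤ m + 1 := by omega
      _ = (m + 1) ^ 1 := (pow_one _).symm
      _ ≤ (m + 1) ^ Nat.log 2 (m + 1) := Nat.pow_le_pow_right (Nat.succ_pos m) hlog
  calc 2 * m * (m + 1) ^ (C * Nat.log 2 (m + 1)) = m * (2 * (m + 1) ^ (C * Nat.log 2 (m + 1))) := by ring
    _ ≤ (2 ^ ((C + 1) * K) * (m * (K + 1)) ^ (C + 1)) * (m + 1) ^ ((C + 1) * Nat.log 2 (m + 1)) :=
        Nat.mul_le_mul (le_trans h2 (Nat.le_mul_of_pos_left _ (by omega))) h3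

end Summit.ValiantsHypothesis.ValiantsHypothesis.Theorems.LacunarySymmetroidMatrixDescartes.Pivot
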